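import Summits.HodgeConjecture.CorCM.KunnethDegreeOne
import HarnessLib

/-!
# COR-CM model facts, exterior-algebra group: the complexified `H¹` of a product — pulled-back
# independent families stay independent (tool for model axiom M15 `Fact_weilLine_rank`)

HONEST FRAMING (cell pub-hodgecm2 / COR-CM): STANDARD facts about Betti cohomology on the tree's real
carriers; nothing about algebraic cycles.

The stage-1 package reads the cohomology of the corner product `P = ((A₀ × A₁) × A₂) × A₃` through the
complexified pull-backs `pullC f k := (pull f k) ⊗ ℂ` along the four projections
`pr₀ = fst ≫ (fst ≫ fst)`, `pr₁ = fst ≫ (fst ≫ snd)`, `pr₂ = fst ≫ snd`, `pr₃ = snd`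
(`HodgeCM/Geometry/Universe.lean`: `pullC`, `prod4`, `pr4`). This file proves, for smooth projective
complex varieties, in exactly that spelling (`BettiUniverse.pull`, `CartesianMonoidalCategory.fst/snd`,
`LinearMap.baseChange ℂ`):

* `pullC_fst_add_pullC_snd_injective` — Künneth in degree one, injectivity half, over `ℂ ⊗_ℚ`:
  `(a, b) ↦ fst^*a + snd^*b` is injective on `(ℂ ⊗ H¹(Y)) × (ℂ ⊗ H¹(Z))` (sections of the projections,
  as in `CorCM/KunnethDegreeOne.lean`);
* `finrank_bettiCohomology_one_tensor` — `dim_ℚ H¹(Y ⊗ Z) = dim_ℚ H¹(Y) + dim_ℚ H¹(Z)`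
  (from `kunneth_one_bijective`);
* `linearIndependent_sum_pullC` — pulling back a linearly independent family from each factor and
  juxtaposing gives a linearly independent family in `ℂ ⊗ H¹(Y ⊗ Z)`;
* `linearIndependent_prod4` — the four-factor version for `P = ((X₀ ⊗ X₁) ⊗ X₂) ⊗ X₃` along
  `pr₀, …, pr₃`, indexed by `((I₀ ⊕ I₁) ⊕ I₂) ⊕ I₃`;
* `finrank_complexified_bettiCohomology_one_prod4` — `dim_ℂ (ℂ ⊗ H¹(P)) = Σᵢ dim_ℚ H¹(Xᵢ)`.

Hatcher Thm. 3.15 (Künneth), Voisin I Thm. 11.38; for abelian varieties Mumford §1 (4).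

## References
* [HatcherAT2002] A. Hatcher, *Algebraic Topology* (2002), §3.2 Thm. 3.15, §3.1 p. 199.
* [VoisinHodgeI2002] C. Voisin, *Hodge Theory and Complex Algebraic Geometry I* (2002), Thm. 11.38.
-/

noncomputable section

open scoped TensorProduct
open CategoryTheory MonoidalCategory CartesianMonoidalCategory
open Literature.AlgebraicTopology.SingularHomology
open Literature.AlgebraicGeometry Literature.AlgebraicGeometry.Motives Literature.AlgebraicGeometry.HodgeTheory

namespace Summit.HodgeConjecture.CorCM.Model

section Binary

variable {m n : ℕ} {Y Z : SchemeOver ℂ}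

/-- `s^* ∘ f^* = (f(ℂ) ∘ s)^*` on `H¹(–; ℚ)` for a continuous `s` and a morphism `f`. [folklore] -/
theorem map_hom_comp_pull {W : Type} [TopologicalSpace W] {X X' : SchemeOver ℂ} (f : X ⟶ X')
    (s : C(W, ComplexPoints X)) (k : ℕ) :
    (singularCohomology.map ℚ ℚ s k).hom ∘ₗ BettiUniverse.pull f k =
      (singularCohomology.map ℚ ℚ ((AlgPoints.mapContinuous (L := ℂ) f).comp s) k).hom := by
  rw [singularCohomology.map_comp, ModuleCat.hom_comp]

/-- A continuous map inducing the identity: `id^* = id`, `hom` form. [folklore] -/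
theorem map_hom_id {W : Type} [TopologicalSpace W] (k : ℕ) :
    (singularCohomology.map ℚ ℚ (ContinuousMap.id W) k).hom = LinearMap.id := by
  rw [singularCohomology.map_id]; rfl

/-- A constant map kills `H¹`, `hom` form. [cite: HatcherAT2002, §3.1 p. 199] -/
theorem map_hom_const {W W' : Type} [TopologicalSpace W] [TopologicalSpace W'] (w : W') :
    (singularCohomology.map ℚ ℚ (ContinuousMap.const W w) 1).hom = 0 := by
  refine LinearMap.ext fun a ↦ ?_
  exact singularCohomology.map_const_of_ne_zero ℚ w one_ne_zero a

/-- **Künneth in degree one over `ℂ ⊗_ℚ`, injectivity**: for `Y, Z` smooth projective over `ℂ`,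
`(a, b) ↦ (fst^* ⊗ ℂ) a + (snd^* ⊗ ℂ) b` is injective on `(ℂ ⊗ H¹(Y(ℂ); ℚ)) × (ℂ ⊗ H¹(Z(ℂ); ℚ))`
(pull back along the sections `y ↦ (y, z₀)`, `z ↦ (y₀, z)`). [cite: HatcherAT2002, §3.2 Thm. 3.15] -/
theorem pullC_fst_add_pullC_snd_injective (hY : IsSmoothProjective m Y) (hZ : IsSmoothProjective n Z) :
    Function.Injective (((BettiUniverse.pull (fst Y Z) 1).baseChange ℂ).coprod
      ((BettiUniverse.pull (snd Y Z) 1).baseChange ℂ)) := by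
  haveI := pathConnectedSpace_complexPoints hY
  haveI := pathConnectedSpace_complexPoints hZ
  obtain ⟨y₀⟩ := (inferInstance : Nonempty (ComplexPoints Y))
  obtain ⟨z₀⟩ := (inferInstance : Nonempty (ComplexPoints Z))
  obtain ⟨sY, hsY₁, hsY₂⟩ := exists_section_fst Y Z z₀
  obtain ⟨sZ, hsZ₁, hsZ₂⟩ := exists_section_snd Y Z y₀
  -- the four composite identities, base-changed
  have eY₁ : ((singularCohomology.map ℚ ℚ sY 1).hom.baseChange ℂ) ∘ₗ (BettiUniverse.pull (fst Y Z) 1).baseChange ℂ =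
      LinearMap.id := by
    rw [← LinearMap.baseChange_comp, map_hom_comp_pull, hsY₁, map_hom_id, LinearMap.baseChange_id]
  have eY₂ : ((singularCohomology.map ℚ ℚ sY 1).hom.baseChange ℂ) ∘ₗ (BettiUniverse.pull (snd Y Z) 1).baseChange ℂ =
      0 := by
    rw [← LinearMap.baseChange_comp, map_hom_comp_pull, hsY₂, map_hom_const, LinearMap.baseChange_zero]
  have eZ₁ : ((singularCohomology.map ℚ ℚ sZ 1).hom.baseChange ℂ) ∘ₗ (BettiUniverse.pull (snd Y Z) 1).baseChange ℂ =
      LinearMap.id := by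
    rw [← LinearMap.baseChange_comp, map_hom_comp_pull, hsZ₁, map_hom_id, LinearMap.baseChange_id]
  have eZ₂ : ((singularCohomology.map ℚ ℚ sZ 1).hom.baseChange ℂ) ∘ₗ (BettiUniverse.pull (fst Y Z) 1).baseChange ℂ =
      0 := by
    rw [← LinearMap.baseChange_comp, map_hom_comp_pull, hsZ₂, map_hom_const, LinearMap.baseChange_zero]
  rw [← LinearMap.ker_eq_bot, Submodule.eq_bot_iff]
  rintro ⟨a, b⟩ hab
  rw [LinearMap.mem_ker, LinearMap.coprod_apply] at hab
  have ha : a = 0 := by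
    have h := congrArg ((singularCohomology.map ℚ ℚ sY 1).hom.baseChange ℂ) hab
    rw [map_add, map_zero, ← LinearMap.comp_apply, ← LinearMap.comp_apply, eY₁, eY₂,
      LinearMap.id_apply, LinearMap.zero_apply, add_zero] at h
    exact h
  have hb : b = 0 := by
    have h := congrArg ((singularCohomology.map ℚ ℚ sZ 1).hom.baseChange ℂ) hab
    rw [map_add, map_zero, ← LinearMap.comp_apply, ← LinearMap.comp_apply, eZ₂, eZ₁,
      LinearMap.id_apply, LinearMap.zero_apply, zero_add] at h
    exact h
  rw [ha, hb]
  rfl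

/-- `dim_ℚ H¹((Y ⊗ Z)(ℂ); ℚ) = dim_ℚ H¹(Y(ℂ); ℚ) + dim_ℚ H¹(Z(ℂ); ℚ)` for `Y, Z` smooth projective
(Künneth in degree one). [cite: VoisinHodgeI2002, Thm. 11.38] -/
theorem finrank_bettiCohomology_one_tensor (hY : IsSmoothProjective m Y) (hZ : IsSmoothProjective n Z) :
    Module.finrank ℚ (bettiCohomology (Y ⊗ Z) 1) =
      Module.finrank ℚ (bettiCohomology Y 1) + Module.finrank ℚ (bettiCohomology Z 1) := by
  haveI : FiniteDimensional ℚ (bettiCohomology Y 1) := finiteDimensional_bettiCohomology hY 1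
  haveI : FiniteDimensional ℚ (bettiCohomology Z 1) := finiteDimensional_bettiCohomology hZ 1
  rw [← (LinearEquiv.ofBijective _ (kunneth_one_bijective hY hZ)).finrank_eq, Module.finrank_prod]

/-- **Juxtaposing pulled-back independent families.** For `Y, Z` smooth projective and linearly
independent families `u` in `ℂ ⊗ H¹(Y)`, `w` in `ℂ ⊗ H¹(Z)`, the family
`Sum.elim ((fst^* ⊗ ℂ) ∘ u) ((snd^* ⊗ ℂ) ∘ w)` is linearly independent in `ℂ ⊗ H¹(Y ⊗ Z)`.
[cite: HatcherAT2002, §3.2 Thm. 3.15] -/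
theorem linearIndependent_sum_pullC (hY : IsSmoothProjective m Y) (hZ : IsSmoothProjective n Z)
    {I J : Type*} {u : I → ℂ ⊗[ℚ] bettiCohomology Y 1} {w : J → ℂ ⊗[ℚ] bettiCohomology Z 1}
    (hu : LinearIndependent ℂ u) (hw : LinearIndependent ℂ w) :
    LinearIndependent ℂ (Sum.elim (fun i ↦ (BettiUniverse.pull (fst Y Z) 1).baseChange ℂ (u i))
      (fun j ↦ (BettiUniverse.pull (snd Y Z) 1).baseChange ℂ (w j))) := by
  set F := (BettiUniverse.pull (fst Y Z) 1).baseChange ℂ with hF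
  set G := (BettiUniverse.pull (snd Y Z) 1).baseChange ℂ with hG
  have hinj := pullC_fst_add_pullC_snd_injective hY hZ
  have hFinj : Function.Injective F := fun a a' h ↦ by
    have : F.coprod G (a, 0) = F.coprod G (a', 0) := by simpa [LinearMap.coprod_apply] using h
    exact (Prod.mk.inj (hinj this)).1
  have hGinj : Function.Injective G := fun b b' h ↦ by
    have : F.coprod G (0, b) = F.coprod G (0, b') := by simpa [LinearMap.coprod_apply] using h
    exact (Prod.mk.inj (hinj this)).2
  have hdisj : Disjoint (LinearMap.range F) (LinearMap.range G) := by
    rw [Submodule.disjoint_def]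
    rintro x ⟨a, rfl⟩ ⟨b, hb⟩
    have h0 : F.coprod G (a, -b) = F.coprod G (0, 0) := by
      rw [LinearMap.coprod_apply, LinearMap.coprod_apply, map_neg, hb, map_zero, map_zero, add_zero,
        add_neg_cancel]
    have := (Prod.mk.inj (hinj h0)).1
    rw [this, map_zero]
  refine LinearIndependent.sum_type (hu.map' F (LinearMap.ker_eq_bot.2 hFinj))
    (hw.map' G (LinearMap.ker_eq_bot.2 hGinj)) (hdisj.mono ?_ ?_)
  · rw [Submodule.span_le]
    rintro _ ⟨i, rfl⟩
    exact ⟨u i, rfl⟩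
  · rw [Submodule.span_le]
    rintro _ ⟨j, rfl⟩
    exact ⟨w j, rfl⟩

/-- `((f ≫ g)^* ⊗ ℂ) x = (f^* ⊗ ℂ) ((g^* ⊗ ℂ) x)`. [folklore] -/
theorem pullC_comp_apply {X X' X'' : SchemeOver ℂ} (f : X ⟶ X') (g : X' ⟶ X'') (k : ℕ)
    (x : ℂ ⊗[ℚ] bettiCohomology X'' k) :
    (BettiUniverse.pull (f ≫ g) k).baseChange ℂ x =
      (BettiUniverse.pull f k).baseChange ℂ ((BettiUniverse.pull g k).baseChange ℂ x) := by
  rw [BettiUniverse.pull_comp, LinearMap.baseChange_comp, LinearMap.comp_apply]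

end Binary

section Prod4

variable {n₀ n₁ n₂ n₃ : ℕ} {X₀ X₁ X₂ X₃ : SchemeOver ℂ}

/-- **Four factors.** For smooth projective `X₀, …, X₃` and linearly independent families `ℓᵢ` in
`ℂ ⊗ H¹(Xᵢ(ℂ); ℚ)`, the family obtained by pulling back `ℓ₀, ℓ₁, ℓ₂, ℓ₃` to
`P = ((X₀ ⊗ X₁) ⊗ X₂) ⊗ X₃` along `pr₀ = fst ≫ (fst ≫ fst)`, `pr₁ = fst ≫ (fst ≫ snd)`, `pr₂ = fst ≫ snd`,
`pr₃ = snd` (the package's `pr4`), indexed by `((I₀ ⊕ I₁) ⊕ I₂) ⊕ I₃`, is linearly independent in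
`ℂ ⊗ H¹(P(ℂ); ℚ)`. [cite: HatcherAT2002, §3.2 Thm. 3.15] -/
theorem linearIndependent_prod4 (h₀ : IsSmoothProjective n₀ X₀) (h₁ : IsSmoothProjective n₁ X₁)
    (h₂ : IsSmoothProjective n₂ X₂) (h₃ : IsSmoothProjective n₃ X₃)
    {I₀ I₁ I₂ I₃ : Type*} {ℓ₀ : I₀ → ℂ ⊗[ℚ] bettiCohomology X₀ 1} {ℓ₁ : I₁ → ℂ ⊗[ℚ] bettiCohomology X₁ 1}
    {ℓ₂ : I₂ → ℂ ⊗[ℚ] bettiCohomology X₂ 1} {ℓ₃ : I₃ → ℂ ⊗[ℚ] bettiCohomology X₃ 1}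
    (hℓ₀ : LinearIndependent ℂ ℓ₀) (hℓ₁ : LinearIndependent ℂ ℓ₁) (hℓ₂ : LinearIndependent ℂ ℓ₂)
    (hℓ₃ : LinearIndependent ℂ ℓ₃) :
    LinearIndependent ℂ (Sum.elim (Sum.elim (Sum.elim
      (fun i ↦ (BettiUniverse.pull (fst ((X₀ ⊗ X₁) ⊗ X₂) X₃ ≫ (fst (X₀ ⊗ X₁) X₂ ≫ fst X₀ X₁)) 1).baseChange ℂ (ℓ₀ i))
      (fun i ↦ (BettiUniverse.pull (fst ((X₀ ⊗ X₁) ⊗ X₂) X₃ ≫ (fst (X₀ ⊗ X₁) X₂ ≫ snd X₀ X₁)) 1).baseChange ℂ (ℓ₁ i)))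
      (fun i ↦ (BettiUniverse.pull (fst ((X₀ ⊗ X₁) ⊗ X₂) X₃ ≫ snd (X₀ ⊗ X₁) X₂) 1).baseChange ℂ (ℓ₂ i)))
      (fun i ↦ (BettiUniverse.pull (snd ((X₀ ⊗ X₁) ⊗ X₂) X₃) 1).baseChange ℂ (ℓ₃ i))) := by
  have h01 : IsSmoothProjective (n₀ + n₁) (X₀ ⊗ X₁) := IsSmoothProjective.tensor_holds h₀ h₁
  have h012 : IsSmoothProjective (n₀ + n₁ + n₂) ((X₀ ⊗ X₁) ⊗ X₂) := IsSmoothProjective.tensor_holds h01 h₂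
  have s1 := linearIndependent_sum_pullC h₀ h₁ hℓ₀ hℓ₁
  have s2 := linearIndependent_sum_pullC h01 h₂ s1 hℓ₂
  have s3 := linearIndependent_sum_pullC h012 h₃ s2 hℓ₃
  convert s3 using 1
  funext x
  rcases x with ((i | i) | i) | i
  · simp only [Sum.elim_inl, pullC_comp_apply]
  · simp only [Sum.elim_inl, Sum.elim_inr, pullC_comp_apply]
  · simp only [Sum.elim_inl, Sum.elim_inr, pullC_comp_apply]
  · simp only [Sum.elim_inr]

/-- `dim_ℂ (ℂ ⊗ H¹(P(ℂ); ℚ)) = Σᵢ dim_ℚ H¹(Xᵢ(ℂ); ℚ)` for `P = ((X₀ ⊗ X₁) ⊗ X₂) ⊗ X₃`.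
[cite: VoisinHodgeI2002, Thm. 11.38] -/
theorem finrank_complexified_bettiCohomology_one_prod4 (h₀ : IsSmoothProjective n₀ X₀)
    (h₁ : IsSmoothProjective n₁ X₁) (h₂ : IsSmoothProjective n₂ X₂) (h₃ : IsSmoothProjective n₃ X₃) :
    Module.finrank ℂ (ℂ ⊗[ℚ] bettiCohomology (((X₀ ⊗ X₁) ⊗ X₂) ⊗ X₃) 1) =
      Module.finrank ℚ (bettiCohomology X₀ 1) + Module.finrank ℚ (bettiCohomology X₁ 1) +
        Module.finrank ℚ (bettiCohomology X₂ 1) + Module.finrank ℚ (bettiCohomology X₃ 1) := by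
  have h01 : IsSmoothProjective (n₀ + n₁) (X₀ ⊗ X₁) := IsSmoothProjective.tensor_holds h₀ h₁
  have h012 : IsSmoothProjective (n₀ + n₁ + n₂) ((X₀ ⊗ X₁) ⊗ X₂) := IsSmoothProjective.tensor_holds h01 h₂
  rw [Module.finrank_baseChange, finrank_bettiCohomology_one_tensor h012 h₃,
    finrank_bettiCohomology_one_tensor h01 h₂, finrank_bettiCohomology_one_tensor h₀ h₁]

end Prod4

end Summit.HodgeConjecture.CorCM.Model

end
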